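import Summits.QuantumFields.YangMills.Theorems.UnitScaleTiltMinimiserStabilityRegPrOfB8Thm2AtT3Members
import Summits.QuantumFields.YangMills.Theorems.FluctuationComparisonRegPrIntLS2BetaWindowExactnessOfTower
import HarnessLib

/-!
# S2β · THE REGISTERED ORGAN ROW EXW∘ (`stub_windowExactness`, v11.4 text VERBATIM) ⟸ THE ONE NAMED LITERATURE FACT `B8Thm2AtT3Members` — NOTHING ELSE;
# and [Balaban1985Variational] THM 1 (8) ∕ the T8 letter AT EVERY BLOCK SIZE from the same name

Cell `ym3-torus` (YM ladder rung R3 = continuum `SU(2)` Yang–Mills on the three-torus at fixed lattice data — a RUNG: NOT d = 4, NOT infinite volume, NOT a mass gap,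
NOT Clay).  Width seat `ym3-torus-px13` (gen 22), FILE A of the pen «the S2β organ road ⟸ one named Literature fact»; helper of the crux `stmt-QuantumFields-20520`
(`…Theses.UnitScaleTilt.FluctuationComparisonRegPrIntL`), `--supports … --as helper`, count-neutral, DEFINITION-FREE (0 `def`, 0 `instance`, 0 `notation`, 0 `sorry`,
default heartbeats).  Registry `Cruxes/FluctuationComparisonRegPrIntL/Lines/semiclassical_s2beta.lean` v11.4 3732b7df FROZEN, untouched.

WHY.  After ✓px13 g21 FILE C (`…S2BetaWindowExactnessOfTower.windowExactness_of_thm1`) the registered row EXW∘ follows from [Balaban1985Variational] Thm 1 (8) in the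
global reading at every odd block size, and (`windowExactness_of_thm1AtThree`) from its `L = 3` instance ALONE — an ANONYMOUS four-binder hypothesis
`∃ a₀ a₁ B₃ > 0, Thm1GlobalMinAt 3 a₀ a₁ B₃`.  Meanwhile the crux 19200 (`MinimiserStabilityRegPr`) is closed MODULO ONE NAMED Literature fact
✓`Literature.….T3B8Thm2AtMembers.B8Thm2AtT3Members` ([Balaban1985RegularSpaces] Thm 2 at the `SU(2)` Setup-torus objects of every member of every T³ family; ★p1 g30
✓`minimiserStabilityRegPr_of_b8Thm2AtT3Members`; by kernel EQUIVALENT to its `L = 3` instance `hThm2S3`, ✓`b8Thm2AtT3Members_iff_hThm2S3`, since `L ≥ 5` is a tree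
theorem ✓`hThm2S_body_of_five_le` and even `L` carry no member).  This file puts the S2β row in the SAME currency: Thm 1 (8) at EVERY block size (`L = 3` included) is
the halving ✓`stub_halvingStep` + the existence clause EX, and EX ⟸ the name (✓`exStub_of_b8Thm2AtT3Members`); so EXW∘ AS REGISTERED ⟸ `B8Thm2AtT3Members`,
NOTHING ELSE — the row's trust base is 19200's, by name.

WHAT (compositions BY NAME; no analysis, no proof copied).
* §1 ★★ `thm1In8GlobalMinAt_of_b8Thm2AtT3Members (hX) (L) (hL : 1 < L)` — Thm 1 (global reading) WITH its (8)-clause at EVERY block size, CONDITIONAL on `hX`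
  (✓`thm1In8GlobalMinAt_of_halving_exist_L` ∘ ✓`stub_halvingStep` ∘ ✓`exStub_of_b8Thm2AtT3Members`); `thm1GlobalMinAt_of_b8Thm2AtT3Members`; the all-`L` letters
  `thm1In8_allL_of_b8Thm2AtT3Members` ∕ `thm1_allL_of_b8Thm2AtT3Members` (the T8 ∕ Thm-1 rows as the doors spell them, `∀ L, Odd L → 1 < L → …`).
* §2 ★★★ `windowExactness_of_b8Thm2AtT3Members (hX : B8Thm2AtT3Members) : ⟨registered `WindowExactness`, v11.4 :1381 text VERBATIM⟩` — **THE REGISTERED ROW EXW∘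
  CLOSED MODULO THE ONE NAMED FACT** (✓`windowExactness_of_thm1` ∘ §1); `windowExactnessExists_of_b8Thm2AtT3Members` (clause (2) alone, ✓`windowExactnessExists_of_thm1`).
* §3 `windowExactness_of_hThm2S3` — the same door keyed on the DISPLAY letter `hThm2S3` ([B8] Thm 2 at the block-size-3 members; ✓`b8Thm2AtT3Members_of_hThm2S3`).

HONEST SCOPE (CREDIT NOTHING): conditional plumbing; `B8Thm2AtT3Members` is OPEN exactly at `L = 3` (the lit-balaban `KIdx.hℓ : 4 ≤ ℓ` ℓ = 2 re-edition; EMBARGO-LITE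
№58 honoured — no Thm-2-at-3 proof is attempted, `hX` is a HYPOTHESIS); the registered stub is NOT landed by a conditional theorem; GAP♯∘ as registered, DET-REP-B,
H4ᶜ∘, LFR♯ᶜ∘, S2β, crux 20520, 19200, `YM3TorusSU2` NOT proved; rung R3 = SU(2) YM₃ on T³ — NOT d = 4, NOT infinite volume, NOT a mass gap, NOT Clay; the Yang–Mills
mass gap is NOT proved.  Sorry-free, axioms standard.

References: T. Bałaban, CMP **102** (1985) 277–309 [Balaban1985Variational] (Thm 1 (8) p.279, Prop. 7 p.299, Prop. 8 p.304); CMP **99** (1985) 75–102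
[Balaban1985RegularSpaces] (Thm 2 p.83, p.77); CMP **102** (1985) 255–275 [Balaban1985UV3] ((7) p.257, (41) p.266).
-/

set_option autoImplicit false

noncomputable section

namespace Summit.QuantumFields.YangMills.Theorems.FluctuationComparisonRegPrIntLS2BetaWindowExactnessOfB8Thm2AtT3Members

open Literature.MathematicalPhysics.QuantumFieldTheory.Balaban1983to89
open Literature.MathematicalPhysics.QuantumFieldTheory.Balaban1983to89.T3ContinuumYM3Torus
open Literature.MathematicalPhysics.QuantumFieldTheory.Balaban1983to89.T3UnitLawDensityEML (ℰp)
open Literature.MathematicalPhysics.QuantumFieldTheory.Balaban1983to89.T3UnitScaleTilt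
open Literature.MathematicalPhysics.QuantumFieldTheory.Balaban1983to89.T3TiltDescent
open Literature.MathematicalPhysics.QuantumFieldTheory.Balaban1983to89.T3ConstrainedMinimiser (fibre)
open Literature.MathematicalPhysics.QuantumFieldTheory.Balaban1983to89.T3PrintedRegularMinimiser
open Literature.MathematicalPhysics.QuantumFieldTheory.Balaban1983to89.T3PrintedMinimiserExistence (Thm1GlobalMinAt)
open Literature.MathematicalPhysics.QuantumFieldTheory.Balaban1983to89.T3LowerAlongMinimisersSplit (MinimisersIn8At)
open Literature.MathematicalPhysics.QuantumFieldTheory.Balaban1983to89.T3B8Thm2AtMembers (B8Thm2AtT3Members)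
open Literature.MathematicalPhysics.QuantumFieldTheory.Balaban1983to89.T3SectALandauChart (eta)
open B8Thm2SetupTorus (Thm2SetupSUAt)
open Literature.MathematicalPhysics.QuantumFieldTheory.Balaban1983to89.T4Continuum
open Summit.QuantumFields.YangMills.Theorems.IntLT8OfHalvingExist (thm1In8GlobalMinAt_of_halving_exist_L)
open Summit.QuantumFields.YangMills.Theorems.MinimiserStabilityRegPrStubHalvingStep (stub_halvingStep)
open Summit.QuantumFields.YangMills.Theorems.MinimiserStabilityRegPrOfB8Thm2AtT3Members (exStub_of_b8Thm2AtT3Members b8Thm2AtT3Members_of_hThm2S3)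
open Summit.QuantumFields.YangMills.Theorems.FluctuationComparisonRegPrIntLWindowExactnessOfGapOrbitThm1 (windowExactnessExists_of_thm1)
open Summit.QuantumFields.YangMills.Theorems.FluctuationComparisonRegPrIntLS2BetaWindowExactnessOfTower (windowExactness_of_thm1)

/-! ## §1 [Balaban1985Variational] Thm 1 (8) ∕ T8 at EVERY block size from the one named fact -/

/-- ★★ **[Balaban1985Variational] THM 1 (GLOBAL READING) WITH ITS (8)-CLAUSE AT EVERY BLOCK SIZE `L > 1`, CONDITIONAL ON THE ONE NAMED FACT**: some `a₀, a₁, B₃ > 0` with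
`Thm1GlobalMinAt L a₀ a₁ B₃ ∧ MinimisersIn8At L a₀ a₁ B₃` — the halving ✓`stub_halvingStep L` (registered stub of 19200, landed) and the existence clause EX at `L`
(✓`exStub_of_b8Thm2AtT3Members hX L`) through ✓`thm1In8GlobalMinAt_of_halving_exist_L`.  At `L ≥ 5` the same conclusion is ✓`thm1In8GlobalMinAt_five` OUTRIGHT; the
content of `hX` is used at `L = 3` only. [cite: Balaban1985Variational, Thm 1 (8) p.279, Prop. 7 p.299, Prop. 8 p.304; Balaban1985RegularSpaces, Thm 2 p.83] -/
theorem thm1In8GlobalMinAt_of_b8Thm2AtT3Members (hX : B8Thm2AtT3Members) (L : ℕ) (hL : 1 < L) :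
    ∃ a₀ a₁ B₃ : ℝ, 0 < a₀ ∧ 0 < a₁ ∧ 0 < B₃ ∧ Thm1GlobalMinAt L a₀ a₁ B₃ ∧ MinimisersIn8At L a₀ a₁ B₃ :=
  thm1In8GlobalMinAt_of_halving_exist_L hL (stub_halvingStep L hL) (exStub_of_b8Thm2AtT3Members hX L hL)

/-- ★★ **[Balaban1985Variational] THM 1 (GLOBAL READING) AT EVERY BLOCK SIZE `L > 1`, CONDITIONAL ON THE ONE NAMED FACT** (first conjunct of
`thm1In8GlobalMinAt_of_b8Thm2AtT3Members`). [cite: Balaban1985Variational, Thm 1 (8) p.279; Balaban1985RegularSpaces, Thm 2 p.83] -/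
theorem thm1GlobalMinAt_of_b8Thm2AtT3Members (hX : B8Thm2AtT3Members) (L : ℕ) (hL : 1 < L) :
    ∃ a₀ a₁ B₃ : ℝ, 0 < a₀ ∧ 0 < a₁ ∧ 0 < B₃ ∧ Thm1GlobalMinAt L a₀ a₁ B₃ := by
  obtain ⟨a₀, a₁, B₃, ha₀, ha₁, hB₃, hT, -⟩ := thm1In8GlobalMinAt_of_b8Thm2AtT3Members hX L hL
  exact ⟨a₀, a₁, B₃, ha₀, ha₁, hB₃, hT⟩

/-- **THE ROW T8 (Thm 1 ∧ (8)) FOR ALL ODD `L > 1`, CONDITIONAL ON THE ONE NAMED FACT** — the shape of ✓`thm1In8_allL_of_three`'s conclusion (19936's T8 door,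
✓`historyTailL_of_thm1In8_selXsV4DataRows_allL`'s letter). [cite: Balaban1985Variational, Thm 1 (8) p.279, Prop. 8 p.304; Balaban1985RegularSpaces, Thm 2 p.83] -/
theorem thm1In8_allL_of_b8Thm2AtT3Members (hX : B8Thm2AtT3Members) :
    ∀ L : ℕ, Odd L → 1 < L → ∃ a₀ a₁ B₃ : ℝ, 0 < a₀ ∧ 0 < a₁ ∧ 0 < B₃ ∧ Thm1GlobalMinAt L a₀ a₁ B₃ ∧ MinimisersIn8At L a₀ a₁ B₃ :=
  fun L _ hL => thm1In8GlobalMinAt_of_b8Thm2AtT3Members hX L hL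

/-- **THE THM-1 LETTER FOR ALL ODD `L > 1`, CONDITIONAL ON THE ONE NAMED FACT** — the `hT` of ✓`windowExactness_of_thm1` VERBATIM.
[cite: Balaban1985Variational, Thm 1 (8) p.279; Balaban1985RegularSpaces, Thm 2 p.83] -/
theorem thm1_allL_of_b8Thm2AtT3Members (hX : B8Thm2AtT3Members) :
    ∀ L : ℕ, Odd L → 1 < L → ∃ a₀ a₁ B₃ : ℝ, 0 < a₀ ∧ 0 < a₁ ∧ 0 < B₃ ∧ Thm1GlobalMinAt L a₀ a₁ B₃ :=
  fun L _ hL => thm1GlobalMinAt_of_b8Thm2AtT3Members hX L hL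

/-! ## §2 ★★★ The registered row EXW∘ ⟸ the one named fact, nothing else -/

/-- ★★★ **THE REGISTERED ORGAN ROW EXW∘ — `stub_windowExactness` of LINE `semiclassical_s2beta` (v11.4 3732b7df :1381), its `def WindowExactness` body VERBATIM —
CLOSED MODULO THE ONE NAMED LITERATURE FACT `B8Thm2AtT3Members`, NOTHING ELSE**: for every block size, on the interior window `PlaqSmall (θBal (cw·b₀))`, the
minimum of the Wilson action over print's regular space (6)(ε₀) is below the action of every good history of the fibre (clause (1), TOWER MONOTONICITY from
Thm 1 (8), ✓px13 g21) and is attained at a regular good history (clause (2)) — ✓`windowExactness_of_thm1` fed by §1.  Trust base = {`B8Thm2AtT3Members`} =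
19200's (✓`minimiserStabilityRegPr_of_b8Thm2AtT3Members`).  CONDITIONAL; the registered stub is NOT landed by this (a stub lands only hypothesis-free).
[cite: Balaban1985Variational, Thm 1 (8) p.279, Prop. 7 p.299, Prop. 8 p.304; Balaban1985RegularSpaces, Thm 2 p.83; Balaban1985UV3, (7) p.257, (41) p.266] -/
theorem windowExactness_of_b8Thm2AtT3Members (hX : B8Thm2AtT3Members) :
    ∀ (L : ℕ), ∃ c₀ : ℝ, 0 < c₀ ∧ c₀ ≤ 1 ∧ ∀ (cw : ℝ), 0 < cw → cw ≤ c₀ → ∃ pS : ℝ, ∀ (b₀ p₀ : ℝ), 0 < b₀ → pS ≤ p₀ → 0 < p₀ → ∃ ε₁ : ℝ, 0 < ε₁ ∧ ∀ (ε₀ : ℝ), 0 < ε₀ → ε₀ ≤ ε₁ →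
    ∃ γ₁ : ℝ, 0 < γ₁ ∧ ∀ (F : T3Family) (γ : ℝ), F.L = L → 0 < γ → γ ≤ γ₁ →
      ∀ (J K : ℕ) (hJK : J ≤ K) (V : GaugeField (F.P J) 0 (Matrix.specialUnitaryGroup (Fin 2) ℂ)), PlaqSmall (θBal F.L γ (cw * b₀) p₀ J) V →
        (∀ U ∈ fibre F ℰp J K hJK V, U ∈ histGood F ℰp (θBal F.L γ b₀ p₀) K J →
            minActionRegPr F J K hJK ε₀ V ≤ wilsonAction4 U) ∧
        (∃ U₀ ∈ regFibrePr F J K hJK ε₀ V, U₀ ∈ histGood F ℰp (θBal F.L γ b₀ p₀) K J ∧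
            wilsonAction4 U₀ = minActionRegPr F J K hJK ε₀ V) :=
  windowExactness_of_thm1 (thm1_allL_of_b8Thm2AtT3Members hX)

/-- **EXW∘'s EXISTENCE CLAUSE (2) ALONE, CONDITIONAL ON THE ONE NAMED FACT** (✓`windowExactnessExists_of_thm1` ∘ §1): on the interior window the minimum over (6)(ε₀) is
attained at a regular good history, at every block size. [cite: Balaban1985Variational, Thm 1 (8) p.279; Balaban1985RegularSpaces, Thm 2 p.83; Balaban1985UV3, (7) p.257] -/
theorem windowExactnessExists_of_b8Thm2AtT3Members (hX : B8Thm2AtT3Members) :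
    ∀ (L : ℕ), ∃ c₀ : ℝ, 0 < c₀ ∧ c₀ ≤ 1 ∧ ∀ (cw : ℝ), 0 < cw → cw ≤ c₀ → ∃ pS : ℝ, ∀ (b₀ p₀ : ℝ), 0 < b₀ → pS ≤ p₀ → 0 < p₀ →
      ∃ ε₁ : ℝ, 0 < ε₁ ∧ ∀ (ε₀ : ℝ), 0 < ε₀ → ε₀ ≤ ε₁ →
      ∃ γ₁ : ℝ, 0 < γ₁ ∧ ∀ (F : T3Family) (γ : ℝ), F.L = L → 0 < γ → γ ≤ γ₁ →
        ∀ (J K : ℕ) (hJK : J ≤ K) (V : GaugeField (F.P J) 0 (Matrix.specialUnitaryGroup (Fin 2) ℂ)), PlaqSmall (θBal F.L γ (cw * b₀) p₀ J) V →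
          ∃ U₀ ∈ regFibrePr F J K hJK ε₀ V, U₀ ∈ histGood F ℰp (θBal F.L γ b₀ p₀) K J ∧
            wilsonAction4 U₀ = minActionRegPr F J K hJK ε₀ V :=
  windowExactnessExists_of_thm1 (thm1_allL_of_b8Thm2AtT3Members hX)

/-! ## §3 The same door keyed on the DISPLAY letter `hThm2S3` ([Balaban1985RegularSpaces] Thm 2 at the block-size-3 members) -/

/-- **THE REGISTERED ROW EXW∘ ⟸ THE DISPLAY LETTER `hThm2S3`** ([B8] Thm 2 at the `SU(2)` Setup-torus objects of the block-size-`3` members, all members, no volume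
floor — the EX display's letter; ✓`b8Thm2AtT3Members_of_hThm2S3` then §2).  CONDITIONAL on `h3`. [cite: Balaban1985RegularSpaces, Thm 2 p.83; Balaban1985Variational, Thm 1 (8) p.279] -/
theorem windowExactness_of_hThm2S3
    (h3 : ∃ B₁ c₁ : ℝ, 0 < B₁ ∧ 0 < c₁ ∧ ∀ (F : T3Family), F.L = 3 → ∀ (n K : ℕ), n < K →
      ∃ (β₀ B₂ : ℝ) (len : B7Prop1Explicit.Site (F.P K).d → ℝ),
        Thm2SetupSUAt (F.P K) 2 (K - n) (eta F n K) β₀ B₁ B₂ c₁ len (fun _ => True)) :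
    ∀ (L : ℕ), ∃ c₀ : ℝ, 0 < c₀ ∧ c₀ ≤ 1 ∧ ∀ (cw : ℝ), 0 < cw → cw ≤ c₀ → ∃ pS : ℝ, ∀ (b₀ p₀ : ℝ), 0 < b₀ → pS ≤ p₀ → 0 < p₀ → ∃ ε₁ : ℝ, 0 < ε₁ ∧ ∀ (ε₀ : ℝ), 0 < ε₀ → ε₀ ≤ ε₁ →
    ∃ γ₁ : ℝ, 0 < γ₁ ∧ ∀ (F : T3Family) (γ : ℝ), F.L = L → 0 < γ → γ ≤ γ₁ →
      ∀ (J K : ℕ) (hJK : J ≤ K) (V : GaugeField (F.P J) 0 (Matrix.specialUnitaryGroup (Fin 2) ℂ)), PlaqSmall (θBal F.L γ (cw * b₀) p₀ J) V →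
        (∀ U ∈ fibre F ℰp J K hJK V, U ∈ histGood F ℰp (θBal F.L γ b₀ p₀) K J →
            minActionRegPr F J K hJK ε₀ V ≤ wilsonAction4 U) ∧
        (∃ U₀ ∈ regFibrePr F J K hJK ε₀ V, U₀ ∈ histGood F ℰp (θBal F.L γ b₀ p₀) K J ∧
            wilsonAction4 U₀ = minActionRegPr F J K hJK ε₀ V) :=
  windowExactness_of_b8Thm2AtT3Members (b8Thm2AtT3Members_of_hThm2S3 h3)

end Summit.QuantumFields.YangMills.Theorems.FluctuationComparisonRegPrIntLS2BetaWindowExactnessOfB8Thm2AtT3Members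

end
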